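import Summits.QuantumFields.YangMills.Theorems.VirialFluxGapFixSliceGrowth
import Summits.QuantumFields.YangMills.Theorems.VirialFluxGapFixSliceLettersDefs
import HarnessLib

/-!
# The Cor-B letters of the slice map: evaluation, linearity, norms, and the CHART IDENTITIES at the base ring
# (layer (B2)/(b) of the DIRECT Laplace road to ⟨stmt-QuantumFields-24204⟩ `VirialFluxGap.SharpTwistedLaplace`)

Helper module (free-hands work of width seat ym-line-sfw-p2-w2 g50, cell ym-idea-1; `--supports 24204`), the sequel of
✓`VirialFluxGapFixSliceLettersDefs` (`sliceLetterA`, `sliceLetterB` — the left-chart exponents of w3 g57's slice map ✓`FixSplit.fixSlice`):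
* §1 evaluation (`sliceLetterA_zero_tree/anchor/off`, `sliceLetterA_succ`, `sliceLetterB_anchor/site`, the case principle `sliceLetterA_zero_cases`)
  and purity (`sliceLetterA_re`, `sliceLetterB_re`);
* §2 LINEARITY in the slice coordinates (`sliceLetterA_add/smul/neg`, `sliceLetterB_add/smul/neg`) — the parity input of the phase model;
* §3 norms: ★ `sum_norm_sq_sliceLetter` (the squared `ℓ²`-norm of the letters IS that of the coordinates), `norm_sliceLetterA_le`, `norm_sliceLetterB_le`;
* §4 ★ the CHART IDENTITIES at the base ring `Q_s` (anchors: seam site `0`, wrap link `((−1,−1,−1),k₀)`; `N_s = centreElem(s k₀)·N₀`):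
  `su2Quat((ι σ(y))_{i,e}) = exp(sliceLetterA y i e)·su2Quat(combFlat w_s e)`, `su2Quat(σ(y).2.2 x) = exp(sliceLetterB y x)·su2Quat(λ_x C₀)`, and their
  `2×2`-matrix forms `coe_ring_fixSlice_link`, `coe_fixSlice_seam` = the hypotheses `hP1`, `hP2` of ✓`ChartPhase.abs_ringDeficit_sub_chartModel_le` and of
  ✓`AnchorSlice.ringDeficit_quadratic_growth_anchorSlice` along `fixSlice`;
* (skew-Hermitian matrix letters: ✓`StrongCouplingSphereCalculus.quatMatrix_conjTranspose_of_re_eq_zero` with `sliceLetterA_re`/`sliceLetterB_re`).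
Everything here is PROVED; no definitions, no named facts (namespace `Summit.QuantumFields.YangMills.Theorems.VirialFluxGap.AnchorSlice`).

HONEST FRAMING: bookkeeping; ⟨24204⟩, ⟨24319⟩, ⟨22884⟩ and every rung stay OPEN; the Yang–Mills mass gap (Clay) is NOT touched; no summit is proved by a line.

## References
* M. Lüscher, Nucl. Phys. B219 (1983), §2. [Luscher1983]
-/

set_option autoImplicit false

noncomputable section

open scoped Quaternion RealInnerProductSpace BigOperators Matrix Matrix.Norms.Frobenius
open NormedSpace Finset
open Literature.MathematicalPhysics.QuantumFieldTheory hiding SU2 su2Quat_mul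
open Literature.MathematicalPhysics.QuantumLattice
open Literature.MathematicalPhysics.QuantumFieldTheory.Balaban1983to89.T4HaarSU2Translate (su2Quat_mul)
open Literature.MathematicalPhysics.QuantumFieldTheory.Balaban1983to89.T4WilsonLinkAffine (su2Quat_inv)
open Literature.MathematicalPhysics.QuantumFieldTheory.Balaban1983to89.T4HaarSU2ExpChart
open Literature.MathematicalPhysics.QuantumFieldTheory.Balaban1983to89.T4QuatExpLog (quatMatrix_exp)
open Summit.QuantumFields.YangMills.Theorems.FemtoTransferGap
open Summit.QuantumFields.YangMills.Theorems.FemtoTransferGap.TT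
open Summit.QuantumFields.YangMills.Theorems.FemtoTransferGap.TwoLattice
open Summit.QuantumFields.YangMills.Theorems.FemtoTransferGap.TwoLattice.Flat
open Summit.QuantumFields.YangMills.Theorems.ToronValleyVolume.Lojasiewicz
open Summit.QuantumFields.YangMills.Theorems.TwistEaterVolume.Quadratic
open Summit.QuantumFields.YangMills.Theorems.VirialFluxGap.RingDeficit
open Summit.QuantumFields.YangMills.Theorems.VirialFluxGap.FixSplit
open Summit.QuantumFields.YangMills.Theorems.QuantitativeLaplace (not_treeEdge_wrap su2Quat_centreElem)

namespace Summit.QuantumFields.YangMills.Theorems.VirialFluxGap.AnchorSlice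

variable {L : ℕ} [NeZero L]

/-! ## §1 Evaluation of the letters -/

section Eval

variable (ωC ωN ωX : EuclideanSpace ℝ (Fin 3)) {e₀ : OffIdx L} {y₀ : Site 3 L} (y : EuclideanSpace ℝ (Fin 3) × RestParam L e₀ y₀)

omit [NeZero L] in
/-- Tree links of slice `0` carry the letter `0`. [folklore] -/
theorem sliceLetterA_zero_tree {e : Edge 3 L} (he : treeEdge e = true) : sliceLetterA ωN ωX y 0 e = 0 := by
  unfold sliceLetterA; rw [Fin.cons_zero]; dsimp only; rw [dif_pos he]

omit [NeZero L] in
/-- The anchor link carries `ι(y.1 1·ω_N + y.1 2·ω_×)`. [folklore] -/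
theorem sliceLetterA_zero_anchor : sliceLetterA ωN ωX y 0 e₀.1 = imQuat ((y.1 1) • ωN + (y.1 2) • ωX) := by
  unfold sliceLetterA; rw [Fin.cons_zero]; dsimp only; rw [dif_neg e₀.2, dif_pos rfl]

omit [NeZero L] in
/-- The other off-tree links of slice `0` carry `ι(y.2.1 i)`. [folklore] -/
theorem sliceLetterA_zero_off (i : {i : OffIdx L // ¬ i = e₀}) : sliceLetterA ωN ωX y 0 i.1.1 = imQuat (y.2.1 i) := by
  unfold sliceLetterA; rw [Fin.cons_zero]; dsimp only
  rw [dif_neg i.1.2, dif_neg (show ¬ (⟨i.1.1, i.1.2⟩ : OffIdx L) = _ from i.2)]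

omit [NeZero L] in
/-- The links of slice `j+1` carry `ι(y.2.2.1 j e)`. [folklore] -/
theorem sliceLetterA_succ (j : Fin (2 * L - 1)) (e : Edge 3 L) : sliceLetterA ωN ωX y j.succ e = imQuat (y.2.2.1 j e) := by
  unfold sliceLetterA; rw [Fin.cons_succ]

omit [NeZero L] in
/-- The anchor site carries `ι(y.1 0·ω_C)`. [folklore] -/
theorem sliceLetterB_anchor : sliceLetterB ωC y y₀ = imQuat ((y.1 0) • ωC) := by
  unfold sliceLetterB; simp

omit [NeZero L] in
/-- The other sites carry `ι(y.2.2.2 x)`. [folklore] -/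
theorem sliceLetterB_site (x : {x : Site 3 L // ¬ x = y₀}) : sliceLetterB ωC y x.1 = imQuat (y.2.2.2 x) := by
  unfold sliceLetterB; dsimp only; rw [dif_neg x.2]

omit [NeZero L] in
/-- A case analysis principle for slice-`0` letters: every edge is a tree link, the anchor link, or another off-tree link. [folklore] -/
theorem sliceLetterA_zero_cases (P : Edge 3 L → ℍ → Prop) (htree : ∀ e, treeEdge e = true → P e 0)
    (hanchor : P e₀.1 (imQuat ((y.1 1) • ωN + (y.1 2) • ωX))) (hoff : ∀ i : {i : OffIdx L // ¬ i = e₀}, P i.1.1 (imQuat (y.2.1 i)))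
    (e : Edge 3 L) : P e (sliceLetterA ωN ωX y 0 e) := by
  by_cases he : treeEdge e = true
  · rw [sliceLetterA_zero_tree ωN ωX y he]; exact htree e he
  · by_cases hi : (⟨e, he⟩ : OffIdx L) = e₀
    · have hee : e = e₀.1 := congrArg Subtype.val hi
      rw [hee, sliceLetterA_zero_anchor]; exact hanchor
    · have h := hoff ⟨⟨e, he⟩, hi⟩
      have h2 := sliceLetterA_zero_off ωN ωX y ⟨⟨e, he⟩, hi⟩
      dsimp only at h h2
      rw [h2]; exact h

/-! ## §2 Purity and linearity in the slice coordinates -/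

omit [NeZero L] in
/-- The letters are imaginary. [folklore] -/
theorem sliceLetterA_re (i : Fin (2 * L - 1 + 1)) (e : Edge 3 L) : (sliceLetterA ωN ωX y i e).re = 0 := by
  refine Fin.cases ?_ (fun j => ?_) i
  · exact sliceLetterA_zero_cases ωN ωX y (fun _ q => q.re = 0) (fun _ _ => rfl) (imQuat_re _) (fun _ => imQuat_re _) e
  · rw [sliceLetterA_succ]; exact imQuat_re _

omit [NeZero L] in
/-- The seam letters are imaginary. [folklore] -/
theorem sliceLetterB_re (x : Site 3 L) : (sliceLetterB ωC y x).re = 0 := by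
  unfold sliceLetterB; split_ifs <;> exact imQuat_re _

end Eval

section Linear

variable (ωC ωN ωX : EuclideanSpace ℝ (Fin 3)) {e₀ : OffIdx L} {y₀ : Site 3 L}

omit [NeZero L] in
/-- `sliceLetterA` is additive in the slice coordinates. [folklore] -/
theorem sliceLetterA_add (y y' : EuclideanSpace ℝ (Fin 3) × RestParam L e₀ y₀) :
    sliceLetterA ωN ωX (y + y') = sliceLetterA ωN ωX y + sliceLetterA ωN ωX y' := by
  funext i e
  rw [Pi.add_apply, Pi.add_apply]
  refine Fin.cases ?_ (fun j => ?_) i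
  · by_cases he : treeEdge e = true
    · rw [sliceLetterA_zero_tree ωN ωX _ he, sliceLetterA_zero_tree ωN ωX _ he, sliceLetterA_zero_tree ωN ωX _ he, add_zero]
    · by_cases hi : (⟨e, he⟩ : OffIdx L) = e₀
      · have hee : e = e₀.1 := congrArg Subtype.val hi
        rw [hee, sliceLetterA_zero_anchor, sliceLetterA_zero_anchor, sliceLetterA_zero_anchor, ← map_add]
        congr 1
        simp only [Prod.fst_add, PiLp.add_apply, add_smul]; abel
      · rw [sliceLetterA_zero_off ωN ωX _ ⟨⟨e, he⟩, hi⟩, sliceLetterA_zero_off ωN ωX _ ⟨⟨e, he⟩, hi⟩,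
          sliceLetterA_zero_off ωN ωX _ ⟨⟨e, he⟩, hi⟩, ← map_add]; rfl
  · rw [sliceLetterA_succ, sliceLetterA_succ, sliceLetterA_succ, ← map_add]; rfl

omit [NeZero L] in
/-- `sliceLetterA` is homogeneous in the slice coordinates. [folklore] -/
theorem sliceLetterA_smul (c : ℝ) (y : EuclideanSpace ℝ (Fin 3) × RestParam L e₀ y₀) :
    sliceLetterA ωN ωX (c • y) = c • sliceLetterA ωN ωX y := by
  funext i e
  rw [Pi.smul_apply, Pi.smul_apply]
  refine Fin.cases ?_ (fun j => ?_) i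
  · by_cases he : treeEdge e = true
    · rw [sliceLetterA_zero_tree ωN ωX _ he, sliceLetterA_zero_tree ωN ωX _ he, smul_zero]
    · by_cases hi : (⟨e, he⟩ : OffIdx L) = e₀
      · have hee : e = e₀.1 := congrArg Subtype.val hi
        rw [hee, sliceLetterA_zero_anchor, sliceLetterA_zero_anchor, ← map_smul]
        congr 1
        simp only [Prod.smul_fst, PiLp.smul_apply, smul_eq_mul, smul_add, smul_smul]
      · rw [sliceLetterA_zero_off ωN ωX _ ⟨⟨e, he⟩, hi⟩, sliceLetterA_zero_off ωN ωX _ ⟨⟨e, he⟩, hi⟩, ← map_smul]; rfl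
  · rw [sliceLetterA_succ, sliceLetterA_succ, ← map_smul]; rfl

omit [NeZero L] in
/-- `sliceLetterA` is odd in the slice coordinates. [folklore] -/
theorem sliceLetterA_neg (y : EuclideanSpace ℝ (Fin 3) × RestParam L e₀ y₀) : sliceLetterA ωN ωX (-y) = -sliceLetterA ωN ωX y := by
  rw [← neg_one_smul ℝ y, sliceLetterA_smul, neg_one_smul]

omit [NeZero L] in
/-- `sliceLetterB` is additive. [folklore] -/
theorem sliceLetterB_add (y y' : EuclideanSpace ℝ (Fin 3) × RestParam L e₀ y₀) :
    sliceLetterB ωC (y + y') = sliceLetterB ωC y + sliceLetterB ωC y' := by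
  funext x
  rw [Pi.add_apply]
  by_cases hx : x = y₀
  · subst hx
    rw [sliceLetterB_anchor, sliceLetterB_anchor, sliceLetterB_anchor, ← map_add]
    congr 1
    simp only [Prod.fst_add, PiLp.add_apply, add_smul]
  · rw [sliceLetterB_site ωC _ ⟨x, hx⟩, sliceLetterB_site ωC _ ⟨x, hx⟩, sliceLetterB_site ωC _ ⟨x, hx⟩, ← map_add]; rfl

omit [NeZero L] in
/-- `sliceLetterB` is homogeneous. [folklore] -/
theorem sliceLetterB_smul (c : ℝ) (y : EuclideanSpace ℝ (Fin 3) × RestParam L e₀ y₀) : sliceLetterB ωC (c • y) = c • sliceLetterB ωC y := by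
  funext x
  rw [Pi.smul_apply]
  by_cases hx : x = y₀
  · subst hx
    rw [sliceLetterB_anchor, sliceLetterB_anchor, ← map_smul]
    congr 1
    simp only [Prod.smul_fst, PiLp.smul_apply, smul_eq_mul, smul_smul]
  · rw [sliceLetterB_site ωC _ ⟨x, hx⟩, sliceLetterB_site ωC _ ⟨x, hx⟩, ← map_smul]; rfl

omit [NeZero L] in
/-- `sliceLetterB` is odd. [folklore] -/
theorem sliceLetterB_neg (y : EuclideanSpace ℝ (Fin 3) × RestParam L e₀ y₀) : sliceLetterB ωC (-y) = -sliceLetterB ωC y := by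
  rw [← neg_one_smul ℝ y, sliceLetterB_smul, neg_one_smul]

end Linear

/-! ## §3 Norms -/

section Norms

variable {ωC ωN ωX : EuclideanSpace ℝ (Fin 3)} {e₀ : OffIdx L} {y₀ : Site 3 L}

omit [NeZero L] in
/-- In an orthonormal frame `‖b₁ω_N + b₂ω_×‖² = b₁² + b₂²`. [folklore] -/
theorem norm_sq_two_frame (hNω : ‖ωN‖ = 1) (hX1 : ‖ωX‖ = 1) (hNX : ⟪ωN, ωX⟫ = 0) (b₁ b₂ : ℝ) :
    ‖b₁ • ωN + b₂ • ωX‖ ^ 2 = b₁ ^ 2 + b₂ ^ 2 := by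
  rw [← real_inner_self_eq_norm_sq, inner_add_left, inner_add_right, inner_add_right, real_inner_smul_left, real_inner_smul_left,
    real_inner_smul_left, real_inner_smul_left, real_inner_smul_right, real_inner_smul_right, real_inner_smul_right, real_inner_smul_right,
    real_inner_self_eq_norm_sq, real_inner_self_eq_norm_sq, hNω, hX1, hNX, real_inner_comm ωN ωX, hNX]
  ring

/-- ★ The squared `ℓ²`-norm of the letters IS the squared `ℓ²`-norm of the slice coordinates. [folklore] -/
theorem sum_norm_sq_sliceLetter (hCω : ‖ωC‖ = 1) (hNω : ‖ωN‖ = 1) (hX1 : ‖ωX‖ = 1) (hNX : ⟪ωN, ωX⟫ = 0)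
    (y : EuclideanSpace ℝ (Fin 3) × RestParam L e₀ y₀) :
    (∑ i, ∑ e, ‖sliceLetterA ωN ωX y i e‖ ^ 2) + ∑ x, ‖sliceLetterB ωC y x‖ ^ 2 =
      (y.1 0) ^ 2 + ((y.1 1) ^ 2 + (y.1 2) ^ 2) + (∑ i, ‖y.2.1 i‖ ^ 2) + (∑ j, ∑ e, ‖y.2.2.1 j e‖ ^ 2) + ∑ x, ‖y.2.2.2 x‖ ^ 2 := by
  have hsumA0 : ∑ e : Edge 3 L, ‖sliceLetterA ωN ωX y 0 e‖ ^ 2 = ((y.1 1) ^ 2 + (y.1 2) ^ 2) + ∑ i, ‖y.2.1 i‖ ^ 2 := by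
    have h1 : ∑ e ∈ Finset.univ.filter (fun e : Edge 3 L => treeEdge e = true), ‖sliceLetterA ωN ωX y 0 e‖ ^ 2 = 0 :=
      Finset.sum_eq_zero fun e he => by rw [Finset.mem_filter] at he; rw [sliceLetterA_zero_tree ωN ωX y he.2, norm_zero]; ring
    have h2 : ∑ e ∈ Finset.univ.filter (fun e : Edge 3 L => ¬ treeEdge e = true), ‖sliceLetterA ωN ωX y 0 e‖ ^ 2 =
        ∑ i : OffIdx L, ‖sliceLetterA ωN ωX y 0 i.1‖ ^ 2 :=
      Finset.sum_subtype (p := fun e : Edge 3 L => ¬ treeEdge e = true) _ (fun e => by rw [Finset.mem_filter]; simp)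
        (fun e => ‖sliceLetterA ωN ωX y 0 e‖ ^ 2)
    have h3 : ∑ i ∈ Finset.univ.erase e₀, ‖sliceLetterA ωN ωX y 0 i.1‖ ^ 2 = ∑ i : {i : OffIdx L // ¬ i = e₀}, ‖sliceLetterA ωN ωX y 0 i.1.1‖ ^ 2 :=
      Finset.sum_subtype (p := fun i : OffIdx L => ¬ i = e₀) _ (fun i => by rw [Finset.mem_erase]; simp) (fun i : OffIdx L => ‖sliceLetterA ωN ωX y 0 i.1‖ ^ 2)
    have h4 : ∑ i : {i : OffIdx L // ¬ i = e₀}, ‖sliceLetterA ωN ωX y 0 i.1.1‖ ^ 2 = ∑ i, ‖y.2.1 i‖ ^ 2 :=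
      Finset.sum_congr rfl fun i _ => by rw [sliceLetterA_zero_off, norm_imQuat]
    have h5 : ‖sliceLetterA ωN ωX y 0 e₀.1‖ ^ 2 = (y.1 1) ^ 2 + (y.1 2) ^ 2 := by
      rw [sliceLetterA_zero_anchor, norm_imQuat, norm_sq_two_frame hNω hX1 hNX]
    rw [← Finset.sum_filter_add_sum_filter_not Finset.univ (fun e : Edge 3 L => treeEdge e = true) (fun e => ‖sliceLetterA ωN ωX y 0 e‖ ^ 2), h1,
      zero_add, h2, ← Finset.add_sum_erase Finset.univ (fun i : OffIdx L => ‖sliceLetterA ωN ωX y 0 i.1‖ ^ 2) (Finset.mem_univ e₀), h3, h4]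
    exact congrArg (· + _) h5
  have hsumA1 : ∀ j : Fin (2 * L - 1), ∑ e, ‖sliceLetterA ωN ωX y j.succ e‖ ^ 2 = ∑ e, ‖y.2.2.1 j e‖ ^ 2 := fun j =>
    Finset.sum_congr rfl fun e _ => by rw [sliceLetterA_succ, norm_imQuat]
  have hsumB : ∑ x, ‖sliceLetterB ωC y x‖ ^ 2 = (y.1 0) ^ 2 + ∑ x, ‖y.2.2.2 x‖ ^ 2 := by
    have h3 : ∑ x ∈ Finset.univ.erase y₀, ‖sliceLetterB ωC y x‖ ^ 2 = ∑ x : {x : Site 3 L // ¬ x = y₀}, ‖sliceLetterB ωC y x.1‖ ^ 2 :=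
      Finset.sum_subtype (p := fun x : Site 3 L => ¬ x = y₀) _ (fun x => by rw [Finset.mem_erase]; simp) (fun x : Site 3 L => ‖sliceLetterB ωC y x‖ ^ 2)
    have h4 : ∑ x : {x : Site 3 L // ¬ x = y₀}, ‖sliceLetterB ωC y x.1‖ ^ 2 = ∑ x, ‖y.2.2.2 x‖ ^ 2 :=
      Finset.sum_congr rfl fun x _ => by rw [sliceLetterB_site, norm_imQuat]
    have h5 : ‖sliceLetterB ωC y y₀‖ ^ 2 = (y.1 0) ^ 2 := by
      rw [sliceLetterB_anchor, norm_imQuat, norm_smul, hCω, mul_one, Real.norm_eq_abs, sq_abs]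
    rw [← Finset.add_sum_erase Finset.univ (fun x : Site 3 L => ‖sliceLetterB ωC y x‖ ^ 2) (Finset.mem_univ y₀), h3, h4, h5]
  rw [Fin.sum_univ_succ, hsumA0, hsumB]
  simp only [hsumA1]
  ring

omit [NeZero L] in
/-- Uniform bound on the link letters from uniform bounds on the coordinates. [folklore] -/
theorem norm_sliceLetterA_le (hNω : ‖ωN‖ = 1) (hX1 : ‖ωX‖ = 1) (hNX : ⟪ωN, ωX⟫ = 0) (y : EuclideanSpace ℝ (Fin 3) × RestParam L e₀ y₀)
    {M : ℝ} (hM : 0 ≤ M) (h12 : (y.1 1) ^ 2 + (y.1 2) ^ 2 ≤ M ^ 2) (h1 : ∀ i, ‖y.2.1 i‖ ≤ M) (h2 : ∀ j e, ‖y.2.2.1 j e‖ ≤ M)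
    (i : Fin (2 * L - 1 + 1)) (e : Edge 3 L) : ‖sliceLetterA ωN ωX y i e‖ ≤ M := by
  refine Fin.cases ?_ (fun j => ?_) i
  · refine sliceLetterA_zero_cases ωN ωX y (fun _ q => ‖q‖ ≤ M) (fun _ _ => by rw [norm_zero]; exact hM) ?_ (fun i => ?_) e
    · rw [norm_imQuat]
      exact (pow_le_pow_iff_left₀ (norm_nonneg _) hM two_ne_zero).mp (by rw [norm_sq_two_frame hNω hX1 hNX]; exact h12)
    · rw [norm_imQuat]; exact h1 i
  · rw [sliceLetterA_succ, norm_imQuat]; exact h2 j e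

omit [NeZero L] in
/-- Uniform bound on the seam letters. [folklore] -/
theorem norm_sliceLetterB_le (hCω : ‖ωC‖ = 1) (y : EuclideanSpace ℝ (Fin 3) × RestParam L e₀ y₀) {M : ℝ} (h0 : |y.1 0| ≤ M)
    (h3 : ∀ x, ‖y.2.2.2 x‖ ≤ M) (x : Site 3 L) : ‖sliceLetterB ωC y x‖ ≤ M := by
  by_cases hx : x = y₀
  · subst hx; rw [sliceLetterB_anchor, norm_imQuat, norm_smul, hCω, mul_one, Real.norm_eq_abs]; exact h0
  · rw [sliceLetterB_site ωC y ⟨x, hx⟩, norm_imQuat]; exact h3 _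

end Norms

/-! ## §4 The chart identities at the base ring `Q_s` (anchors: seam site `0`, wrap link `((−1,−1,−1),k₀)`) -/

section Chart

variable {z : Fin 3 → Bool} {k₀ : Fin 3} {lam : Site 3 L → SU2} {N₀ C₀ : SU2} {ωC ωN ωX : EuclideanSpace ℝ (Fin 3)} {s : Fin 3 → Bool}

omit [NeZero L] in
/-- ★ **Link chart identity**: `su2Quat((ι σ(y))_{i,e}) = exp(sliceLetterA y i e)·su2Quat(combFlat w_s e)` when the remaining link components of
the base are those of `Q_s`. [cite: Luscher1983, §2] -/
theorem su2Quat_ring_fixSlice_link (hL : 2 ≤ L) (hk₀ : z k₀ = true)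
    {R : FixRest L ⟨(((fun _ => (-1 : ZMod L)), k₀) : Edge 3 L), not_treeEdge_wrap hL k₀⟩ 0}
    (hR1 : ∀ i, R.1 i = combFlat (fun a => centreElem (s a) * (if z a then N₀ else 1)) i.1.1)
    (hR2 : ∀ j e, R.2.1 j e = combFlat (fun a => centreElem (s a) * (if z a then N₀ else 1)) e)
    (y : EuclideanSpace ℝ (Fin 3) × RestParam L ⟨(((fun _ => (-1 : ZMod L)), k₀) : Edge 3 L), not_treeEdge_wrap hL k₀⟩ 0)
    (i : Fin (2 * L - 1 + 1)) (e : Edge 3 L) :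
    su2Quat ((Fin.cons (glue (fixSlice ωC ωN ωX C₀ (centreElem (s k₀) * N₀) R y).1) (fixSlice ωC ωN ωX C₀ (centreElem (s k₀) * N₀) R y).2.1 :
        Fin (2 * L - 1 + 1) → GaugeConfig 3 L SU2) i e) =
      exp (sliceLetterA ωN ωX y i e) * su2Quat (combFlat (fun a => centreElem (s a) * (if z a then N₀ else 1)) e) := by
  obtain ⟨W, hW⟩ : ∃ W : GaugeConfig 3 L SU2, W = combFlat (fun a => centreElem (s a) * (if z a then N₀ else 1)) := ⟨_, rfl⟩
  simp_rw [← hW] at hR1 hR2 ⊢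
  have hWe₀ : W (((fun _ => (-1 : ZMod L)), k₀) : Edge 3 L) = centreElem (s k₀) * N₀ := by
    rw [hW, combFlat_apply, if_pos (show ((fun _ => (-1 : ZMod L)) : Site 3 L) k₀ = -1 from rfl)]
    show centreElem (s k₀) * (if z k₀ then N₀ else 1) = centreElem (s k₀) * N₀
    rw [if_pos hk₀]
  refine Fin.cases ?_ (fun j => ?_) i
  · rw [Fin.cons_zero]
    by_cases he : treeEdge e = true
    · rw [glue_apply_of_tree _ he, sliceLetterA_zero_tree ωN ωX y he, hW, combFlat_apply_of_tree _ he, FemtoTransferGap.su2Quat_one,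
        NormedSpace.exp_zero, one_mul]
    · rw [glue_apply_of_not_tree _ he]
      by_cases hi : (⟨e, he⟩ : OffIdx L) = ⟨(((fun _ => (-1 : ZMod L)), k₀) : Edge 3 L), not_treeEdge_wrap hL k₀⟩
      · have hee : e = (((fun _ => (-1 : ZMod L)), k₀) : Edge 3 L) := congrArg Subtype.val hi
        have ha := sliceLetterA_zero_anchor ωN ωX y
        dsimp only at ha
        rw [hi, fixSlice_link, hee, ha, hWe₀]
        show su2Quat (expPoint ((y.1 1) • ωN + (y.1 2) • ωX) * (centreElem (s k₀) * N₀)) = _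
        rw [su2Quat_mul, su2Quat_expPoint]
      · have h := fixSlice_off ωC ωN ωX C₀ (centreElem (s k₀) * N₀) R y ⟨⟨e, he⟩, hi⟩
        have ha := sliceLetterA_zero_off ωN ωX y ⟨⟨e, he⟩, hi⟩
        dsimp only at h ha
        rw [h, hR1, ha, su2Quat_mul, su2Quat_expPoint]
  · rw [Fin.cons_succ, fixSlice_slice, hR2, sliceLetterA_succ, su2Quat_mul, su2Quat_expPoint]

omit [NeZero L] in
/-- ★ **Seam chart identity**: `su2Quat(σ(y).2.2 x) = exp(sliceLetterB y x)·su2Quat(λ_x C₀)` when the remaining seam components of the base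
are those of `Q_s` (`λ_0 = 1`). [cite: Luscher1983, §2] -/
theorem su2Quat_fixSlice_seam (hlam0 : lam 0 = 1) {e₀ : OffIdx L} {R : FixRest L e₀ 0} (hR3 : ∀ x, R.2.2 x = lam x.1 * C₀)
    (N₀' : SU2) (y : EuclideanSpace ℝ (Fin 3) × RestParam L e₀ 0) (x : Site 3 L) :
    su2Quat ((fixSlice ωC ωN ωX C₀ N₀' R y).2.2 x) = exp (sliceLetterB ωC y x) * su2Quat (lam x * C₀) := by
  by_cases hx : x = 0
  · subst hx
    rw [fixSlice_seam, sliceLetterB_anchor, hlam0, one_mul]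
    show su2Quat (expPoint ((y.1 0) • ωC) * C₀) = _
    rw [su2Quat_mul, su2Quat_expPoint]
  · have h := fixSlice_site ωC ωN ωX C₀ N₀' R y ⟨x, hx⟩
    have hb := sliceLetterB_site ωC y ⟨x, hx⟩
    dsimp only at h hb
    rw [h, hR3, hb, su2Quat_mul, su2Quat_expPoint]

omit [NeZero L] in
/-- Matrix form of the link chart identity (the `hP1` of ✓`ChartPhase.abs_ringDeficit_sub_chartModel_le`). [cite: Luscher1983, §2] -/
theorem coe_ring_fixSlice_link (hL : 2 ≤ L) (hk₀ : z k₀ = true)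
    {R : FixRest L ⟨(((fun _ => (-1 : ZMod L)), k₀) : Edge 3 L), not_treeEdge_wrap hL k₀⟩ 0}
    (hR1 : ∀ i, R.1 i = combFlat (fun a => centreElem (s a) * (if z a then N₀ else 1)) i.1.1)
    (hR2 : ∀ j e, R.2.1 j e = combFlat (fun a => centreElem (s a) * (if z a then N₀ else 1)) e)
    (y : EuclideanSpace ℝ (Fin 3) × RestParam L ⟨(((fun _ => (-1 : ZMod L)), k₀) : Edge 3 L), not_treeEdge_wrap hL k₀⟩ 0)
    (i : Fin (2 * L - 1 + 1)) (e : Edge 3 L) :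
    (((Fin.cons (glue (fixSlice ωC ωN ωX C₀ (centreElem (s k₀) * N₀) R y).1) (fixSlice ωC ωN ωX C₀ (centreElem (s k₀) * N₀) R y).2.1 :
        Fin (2 * L - 1 + 1) → GaugeConfig 3 L SU2) i e : SU2) : Matrix (Fin 2) (Fin 2) ℂ) =
      exp (quatMatrix (sliceLetterA ωN ωX y i e)) *
        ((combFlat (fun a => centreElem (s a) * (if z a then N₀ else 1)) e : SU2) : Matrix (Fin 2) (Fin 2) ℂ) := by
  rw [← quatMatrix_su2Quat, su2Quat_ring_fixSlice_link hL hk₀ hR1 hR2 y i e, quatMatrix_mul, quatMatrix_exp, quatMatrix_su2Quat]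

omit [NeZero L] in
/-- Matrix form of the seam chart identity (the `hP2` of ✓`ChartPhase.abs_ringDeficit_sub_chartModel_le`). [cite: Luscher1983, §2] -/
theorem coe_fixSlice_seam (hlam0 : lam 0 = 1) {e₀ : OffIdx L} {R : FixRest L e₀ 0} (hR3 : ∀ x, R.2.2 x = lam x.1 * C₀)
    (N₀' : SU2) (y : EuclideanSpace ℝ (Fin 3) × RestParam L e₀ 0) (x : Site 3 L) :
    (((fixSlice ωC ωN ωX C₀ N₀' R y).2.2 x : SU2) : Matrix (Fin 2) (Fin 2) ℂ) =
      exp (quatMatrix (sliceLetterB ωC y x)) * ((lam x * C₀ : SU2) : Matrix (Fin 2) (Fin 2) ℂ) := by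
  rw [← quatMatrix_su2Quat, su2Quat_fixSlice_seam hlam0 hR3 N₀' y x, quatMatrix_mul, quatMatrix_exp, quatMatrix_su2Quat]

end Chart

/- §5: the matrix letters are skew-Hermitian — use ✓`StrongCouplingSphereCalculus.quatMatrix_conjTranspose_of_re_eq_zero`
(`(quatMatrix q)ᴴ = −quatMatrix q` for `q.re = 0`, module `Summits.QuantumFields.BalabanUV.InfraRed.StrongCouplingSphereCalculus`). -/

end Summit.QuantumFields.YangMills.Theorems.VirialFluxGap.AnchorSlice
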